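import Literature.Probability.LatticeModels.AnnulusManeuver
import Literature.Probability.LatticeModels.WeakBeurlingEstimate
import Literature.Probability.LatticeModels.InnerFacesHoleFree
import HarnessLib

/-!
# The weak Beurling estimate on `ℤ²`, hole-free form with explicit scales (Smirnov 2010, Lemma B.2)

Topic `Literature/Probability/LatticeModels`. The tree ALREADY contains a fully proved weak
Beurling estimate for the same source statement (Smirnov 2010, App. B, Lemma B.2, after Kesten
1987): `weakBeurling`, `weakBeurling_of_cutPath`, `weakBeurling_of_noCircuit` in
`WeakBeurlingEstimate.lean` (item P5 of the road of `Sweep1Proofs.lean` §2b, consumed by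
`LatticeHarmonicMeasure.lean`). **This file is a second, independent route to the same lemma with
a different hypothesis and output form, kept because its consumer uses exactly this form**:

* hypothesis — `HoleFree K` for a set `K ⊇ S` of sites (every site off `K` escapes to infinity
  through sites off `K`, `HoleFreePotential.lean`) together with a site `F₀ ∉ K` near the base
  point, instead of an explicit cut path from the base point (`weakBeurling_of_cutPath`) or the
  no-circuit condition (`weakBeurling_of_noCircuit`); the consumer `BoundaryEstimate.lean`
  (boundary values of the FK primitive, Smirnov's Theorem 5.3 step) takes `K` to be the
  complement of the exterior lattice component `ExtConn D δ` of a Jordan domain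
  (`ExteriorLatticePath.lean`, `holeFree_compl_extConn`), for which hole-freeness is the natural
  certificate, and feeds `F₀` from `eventually_exists_extConn_near`;
* output — the explicit geometric form `u ≤ (1 - c_*)^J` on the box `sqBox c (12k₀)` whenever
  `10 · 5^J · k₀ ≤ R`, with the one-scale constant `c_* = maneuverConst` of the 12-step box-exit
  maneuver (`AnnulusManeuver.lean`, `maneuverConst_le_killedIn`), instead of
  `beurlingConst · ((ρ+1)/(R+1))^beurlingExp`; `BoundaryEstimate.sub_le_eta_add_pow` and
  `BoundaryValues.lean` choose `J` from the target `η` directly in this form.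

Statement proved here (`weakBeurling_of_holeFree`): for `K ⊆ ℤ²` hole-free, `S ⊆ K`, a site
`F₀ ∉ K` in `sqBox c (12k₀)`, and `u` harmonic on `S ∩ sqBox c R` with `0 ≤ u ≤ 1` and `u = 0`
on `sqBox c R ∖ S`: `u ≤ (1 - c_*)^J` on `sqBox c (12k₀)` whenever `10 · 5^J k₀ ≤ R`. The scales
are `k_j = 5^j k₀`; at each scale the comparison principle gives
`u ≤ (max over the next box) · (1 - killedIn)` (`le_mul_one_sub_killedIn`), and `killedIn ≥ c_*`.
The box `sqBox` and its lemmas are those of `WeakBeurlingEstimate.lean`. Everything is proved.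

* `mB_eq_sqBox`, `mW_eq_sqBox`, `killedIn_of_not_mem`, `le_mul_one_sub_killedIn`,
  **`weakBeurling_of_holeFree`**.

## References

* S. Smirnov, Ann. of Math. 172 (2010) 1435–1467, App. B, Lemma B.2 — bib key `Smirnov2010`.
* H. Kesten, Hitting probabilities of random walks on `ℤ^d`, Stoch. Proc. Appl. 25 (1987) 165–184.
-/

noncomputable section

namespace Literature.Probability.LatticeModels

open Set
open WeakBeurling (sqBox sqBox_mono mem_sqBox_succ_of_adj)

/-- `mB c k = sqBox c (12k)`. [folklore] -/
theorem mB_eq_sqBox (c : Site 2) (k : ℕ) : mB c k = sqBox c (12 * k) := rfl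

/-- `mW c k = sqBox c (48k)`. [folklore] -/
theorem mW_eq_sqBox (c : Site 2) (k : ℕ) : mW c k = sqBox c (48 * k) := rfl

/-- `killedIn S W = 0` off `W`. [folklore] -/
theorem killedIn_of_not_mem {S W : Set (Site 2)} (hW : W.Finite) {x : Site 2} (hx : x ∉ W) : killedIn S W x = 0 := by
  classical
  have hfin : (S ∩ W).Finite := hW.subset inter_subset_right
  rw [killedIn, harmExt_of_not_mem hfin _ (fun h => hx h.2), if_neg hx]

/-- **One scale of the weak Beurling iteration.** Let `u` be harmonic on `S ∩ sqBox c R`,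
`u ≤ M` on `sqBox c (60k)`, `u = 0` on `sqBox c R ∖ S`, `u ≥ 0`, with `48k + 1 ≤ 60k ≤ R`…
precisely `48 k < R`. Then `u ≤ M (1 - killedIn S (mW c k))` on `S ∩ mW c k`. [folklore] -/
theorem le_mul_one_sub_killedIn {S : Set (Site 2)} {c : Site 2} {k : ℕ} (hk : 0 < k) {R : ℤ} (hR : 48 * (k : ℤ) < R)
    {u : Site 2 → ℝ} (hu : IsLatticeHarmonicOn u (S ∩ sqBox c R))
    (hzero : ∀ x ∈ sqBox c R, x ∉ S → u x = 0) {M : ℝ} (hM : ∀ x ∈ sqBox c (60 * k), u x ≤ M)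
    {x : Site 2} (hx : x ∈ S ∩ mW c k) :
    u x ≤ M * (1 - killedIn S (mW c k) x) := by
  classical
  have hWfin := mW_finite c k
  have hfin : (S ∩ mW c k).Finite := hWfin.subset inter_subset_right
  have hWR : mW c k ⊆ sqBox c R := by rw [mW_eq_sqBox]; exact sqBox_mono c (by linarith)
  -- `φ = M (1 - killedIn) - u` is harmonic on `S ∩ mW` and nonnegative on its outer boundary
  set φ : Site 2 → ℝ := fun y => M * (1 - killedIn S (mW c k) y) - u y with hφ
  have hsuper : IsLatticeSuperharmonicOn φ (S ∩ mW c k) := by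
    intro y hy
    have h1 : latticeLaplacian (killedIn S (mW c k)) y = 0 := by
      rw [killedIn]; exact harmExt_harmonicOn hfin _ y hy
    have h2 : latticeLaplacian u y = 0 := hu y ⟨hy.1, hWR hy.2⟩
    have e : φ = (fun y => M * 1 + (-M) * killedIn S (mW c k) y) - u := by
      funext y; simp only [hφ, Pi.sub_apply]; ring
    rw [e, latticeLaplacian_sub, show (fun y => M * 1 + -M * killedIn S (mW c k) y) =
      (fun _ => M * 1) + (fun y => -M * killedIn S (mW c k) y) from rfl, latticeLaplacian_add,
      latticeLaplacian_const, show (fun y => -M * killedIn S (mW c k) y) = fun y => -M * killedIn S (mW c k) y from rfl,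
      latticeLaplacian_const_mul, h1, h2]
    simp
  have hbd : ∀ w ∈ latticeOuterBoundary (S ∩ mW c k), 0 ≤ φ w := by
    rintro w ⟨hwSW, v, hv, e, rfl⟩
    by_cases hwW : v + cornerUnit e ∈ mW c k
    · -- in the region but not in `S`: `killedIn = 1`, `u = 0`
      have hwS : v + cornerUnit e ∉ S := fun h => hwSW ⟨h, hwW⟩
      simp only [hφ, killedIn_of_mem_diff hWfin hwW hwS, hzero _ (hWR hwW) hwS]; norm_num
    · -- outside the region: `killedIn = 0`, `u ≤ M`
      simp only [hφ, killedIn_of_not_mem hWfin hwW, sub_zero, mul_one, sub_nonneg]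
      refine hM _ ?_
      have := mem_sqBox_succ_of_adj (p := c) (n := 48 * k) (by rw [← mW_eq_sqBox]; exact hv.2) (zdGraph_adj_add_cornerUnit v e)
      exact sqBox_mono c (by omega) this
  have key := hsuper.ge_of_forall_boundary_ge hfin (M := 0) hbd x hx
  simp only [hφ] at key
  linarith

/-- **The weak Beurling estimate, hole-free form with explicit scales** (Smirnov 2010, Lemma B.2;
Kesten 1987) — a variant of the tree's `weakBeurling_of_cutPath` / `weakBeurling_of_noCircuit`
(`WeakBeurlingEstimate.lean`) with the hypothesis `HoleFree K`, `S ⊆ K`, a site `F₀ ∉ K` within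
sup-distance `12k₀` of `c` (instead of a cut path from the base point) and the output
`(1 - maneuverConst)^J` at the scales `5^j k₀` (instead of `beurlingConst · t^beurlingExp`), the
form used by `BoundaryEstimate.lean`. Let `u` be harmonic on `S ∩ sqBox c R` with `0 ≤ u ≤ 1`
and `u = 0` on `sqBox c R ∖ S`. Then `u ≤ (1 - c_*)^J` on `sqBox c (12k₀)` as soon as
`10 · 5^J · k₀ ≤ R`: each of the `J` annuli between the scales `k_j = 5^j k₀` kills the walk with
probability `≥ c_*` (`maneuverConst_le_killedIn`). [cite: Smirnov2010, Lemma B.2] -/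
theorem weakBeurling_of_holeFree {K S : Set (Site 2)} (hK : HoleFree K) (hSK : S ⊆ K) (c : Site 2) {k₀ : ℕ} (hk₀ : 0 < k₀)
    {F₀ : Site 2} (hF₀ : F₀ ∉ K) (hF₀c : F₀ ∈ mB c k₀) {R : ℤ} {u : Site 2 → ℝ}
    (hu : IsLatticeHarmonicOn u (S ∩ sqBox c R)) (h01 : ∀ x, 0 ≤ u x ∧ u x ≤ 1)
    (hzero : ∀ x ∈ sqBox c R, x ∉ S → u x = 0) (J : ℕ) (hJ : 10 * 5 ^ J * (k₀ : ℤ) ≤ R)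
    {x : Site 2} (hx : x ∈ mB c k₀) : u x ≤ (1 - maneuverConst) ^ J := by
  -- `P j : u ≤ (1 - c_*)^(J - j)` on `mB c (5^j k₀)`, by downward induction on `j ≤ J`
  have hc := maneuverConst_pos
  have hc1 := maneuverConst_le_one
  suffices P : ∀ i : ℕ, i ≤ J → ∀ y ∈ mB c (5 ^ (J - i) * k₀), u y ≤ (1 - maneuverConst) ^ i by
    have := P J le_rfl x (by simpa using hx)
    exact this
  intro i
  induction i with
  | zero => intro _ y _; simpa using (h01 y).2
  | succ i ih =>
    intro hi y hy
    set k := 5 ^ (J - (i + 1)) * k₀ with hkdef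
    have hk : 0 < k := Nat.mul_pos (pow_pos (by norm_num) _) hk₀
    have hk5 : 5 ^ (J - i) * k₀ = 5 * k := by
      rw [hkdef, ← mul_assoc, ← pow_succ']; congr 2; omega
    -- the region of scale `k` lies in the big box
    have hkR : 48 * (k : ℤ) < R := by
      have h1 : (5 : ℤ) * 5 ^ (J - (i + 1)) ≤ 5 ^ J := by
        rw [← pow_succ']; exact pow_le_pow_right₀ (by norm_num) (by omega)
      have h2 : (k : ℤ) = 5 ^ (J - (i + 1)) * k₀ := by rw [hkdef]; push_cast; ring
      have h3 : (0 : ℤ) < k₀ := by exact_mod_cast hk₀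
      have h4 : (0 : ℤ) < k := by exact_mod_cast hk
      have h5 : 50 * (k : ℤ) ≤ 10 * 5 ^ J * k₀ := by rw [h2]; nlinarith
      linarith
    by_cases hyS : y ∈ S
    · have hyW : y ∈ mW c k := by
        rw [mW_eq_sqBox]; rw [mB_eq_sqBox] at hy; exact sqBox_mono c (by omega) hy
      have hM : ∀ w ∈ sqBox c (60 * k), u w ≤ (1 - maneuverConst) ^ i := fun w hw =>
        ih (by omega) w (by rw [mB_eq_sqBox, hk5]; push_cast; rw [show (12 : ℤ) * (5 * k) = 60 * k by ring]; exact hw)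
      have h1 := le_mul_one_sub_killedIn hk hkR hu hzero hM ⟨hyS, hyW⟩
      have h2 : maneuverConst ≤ killedIn S (mW c k) y :=
        maneuverConst_le_killedIn hK hSK hk hF₀ (by
          rw [mB_eq_sqBox] at hF₀c ⊢
          refine sqBox_mono c ?_ hF₀c
          have : k₀ ≤ k := by rw [hkdef]; exact Nat.le_mul_of_pos_left _ (pow_pos (by norm_num) _)
          omega) hy
      calc u y ≤ (1 - maneuverConst) ^ i * (1 - killedIn S (mW c k) y) := h1
        _ ≤ (1 - maneuverConst) ^ i * (1 - maneuverConst) := by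
            have h0 : 0 ≤ (1 - maneuverConst) ^ i := pow_nonneg (by linarith) i
            gcongr
        _ = (1 - maneuverConst) ^ (i + 1) := by ring
    · have hyR : y ∈ sqBox c R := by
        rw [mB_eq_sqBox] at hy; exact sqBox_mono c (by nlinarith) hy
      rw [hzero y hyR hyS]
      exact pow_nonneg (by linarith) _

end Literature.Probability.LatticeModels
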